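import Summits.AtomisticToContinuum.Crystallization.Theorems.ChartedZeroExcessLayeredLatticeLiouvilleXG

/-!
# Zero-excess layered lattice Liouville — part XH (lens-2 g59, node «SBGlueC2», first half): THE DEFECT PAIRING AND THE LIFTED TEST FIELD

Critic rows 1051/1119 (ORDER OF RECORD for `stmt-AtomisticToContinuum-26636`): leaf (2) `SubWindowBudgetGlueBPG` via SBGlueA–D.  Memo NODE-g59a §2 (E1): one step of
the index-side Campanato recursion starts with the COMPARISON ESTIMATE — (HC) `HarmonicComparisonZ` bounds `κ₁·E(φ − V)` by the residual pairing
`|Σ_P ⟪truncResidual φ X, (φ − V) X⟫|`, and (PT) `LinearisationDefectP` rewrites `truncResidual φ X = −tailForce (atomOf X) − defectSum φ X`.  This file supplies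
the two finite-sum identities + bounds that turn the right-hand side into energies (all PROVED):

* XH.1 THE DEFECT PAIRING: (PT)'s defect sum `defectSum` as a finite sum over a window `U ⊇` the `ϱ`-near sites (US `tsum_ite_near_eq_sum`), the pair finset
  `nearPairs U ϱ`, the ANTISYMMETRISATION `Σ_U ⟪defectSum X, ψ X⟫ = ½ Σ_{nearPairs} ⟪G X Y, ψ X − ψ Y⟫` (`G Y X = −G X Y` from Q `defectKernel_neg_neg`), hence
  `|Σ_P ⟪defectSum, ψ⟫| ≤ ½ Σ_{nearPairs} ‖G‖·‖ψ X − ψ Y‖` (`abs_sum_inner_defectSum_le`).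
* XH.2 (I1) + CAUCHY–SCHWARZ: with the Taylor constant `C_T` of Q `norm_defectKernel_le` (a hypothesis here), `27/32`-separation of the model set and a gradient bound
  `‖φ X − φ Y‖ ≤ δ⋆ ≤ 1/4` on near pairs: `Σ ‖G‖‖ψX − ψY‖ ≤ C_T·δ⋆·√(Σ‖φX−φY‖²)·√(Σ‖ψX−ψY‖²)` (`sum_nearPairs_defect_le`).
* XH.3 NEAR-PAIR SUMS ARE INDEX ENERGIES: `Σ_{nearPairs (idxBallF X₀ m) ϱ} ‖f X − f Y‖² ≤ dictA c ϱ · idxEnergy f (idxBall X₀ m)` (`sum_nearPairs_sq_le`; the XF.3 re-indexing).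
* XH.4 VANISHING TEST FIELDS: `idxEnergy ψ B = idxEnergy ψ (nbhd1 P)` for `ψ = 0` off `P`, `nbhd1 P ⊆ B` (`idxEnergy_eq_nbhd1_of_vanish`) — (HC)'s energy set.
* XH.5 THE LIFTED TEST FIELD `liftField S Ψ a b w ψ = 1_S · ψ ∘ idxOf ∘ Ψ`: it vanishes off `S ∩ ball x t` when the atoms of `P` lie in `ball x t`, its pairing with any
  force field is `Σ_P ⟪F (atomOf X), ψ X⟫` (`finsum_inner_liftField_eq`), and its bond energy is `≤ dictA c D · idxEnergy ψ` (`bondEnergy_liftField_le`) — so (I4ˢ)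
  `TailFluxBSP` can be tested against `(φ − V) ∘ idxOf ∘ Ψ`.  Part XI assembles (E1) from these.
-/

noncomputable section

open scoped BigOperators InnerProductSpace RealInnerProductSpace
open Set Function Metric
open Summit.AtomisticToContinuum.Crystallization.Theorems.ChartedPlanarOrderRigidityDoor (E3 IsClean)
open Summit.AtomisticToContinuum.Crystallization.Theorems.ChartedPlanarOrderDensityDichotomy (μS IsSep nK)
open Summit.AtomisticToContinuum.Crystallization.Theorems.ChartedPlanarOrderDoorLayered (Layered)

namespace Summit.AtomisticToContinuum.Crystallization.Theorems.ChartedZeroExcessLayeredLatticeLiouville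

/-! ### XH.1  The defect pairing: finite form and antisymmetrisation -/

section Defect

variable {a b : E3} {w : ℤ → E3} {c ϱ : ℝ}

/-- (PT)'s DEFECT SUM at the index site `X` (the right-hand side of `LinearisationDefectP` is `−defectSum`). [this file, g59] -/
def defectSum (ϱ : ℝ) (a b : E3) (w : ℤ → E3) (φ : Cell 2 → ℤ → E3) (X : Cell 2 × ℤ) : E3 :=
  ∑' Y : Cell 2 × ℤ, (if Y ≠ X ∧ ‖lsite a b w Y.1 Y.2 - lsite a b w X.1 X.2‖ ≤ ϱ then
    defectKernel (lsite a b w X.1 X.2 - lsite a b w Y.1 Y.2) (φ X.1 X.2 - φ Y.1 Y.2) else 0)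

/-- the defect pair kernel `G X Y = defectKernel (lsite X − lsite Y) (φ X − φ Y)`. [this file, g59] -/
def defectPair (a b : E3) (w : ℤ → E3) (φ : Cell 2 → ℤ → E3) (X Y : Cell 2 × ℤ) : E3 :=
  defectKernel (lsite a b w X.1 X.2 - lsite a b w Y.1 Y.2) (φ X.1 X.2 - φ Y.1 Y.2)

/-- antisymmetry of the defect pair kernel (Q `defectKernel_neg_neg`). [this file, g59] -/
theorem defectPair_swap (φ : Cell 2 → ℤ → E3) (X Y : Cell 2 × ℤ) : defectPair a b w φ Y X = -defectPair a b w φ X Y := by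
  unfold defectPair
  rw [← defectKernel_neg_neg, neg_sub, neg_sub]

/-- the `ϱ`-NEAR PAIRS of a finite index window `U` (ordered, off-diagonal). [this file, g59] -/
def nearPairs (a b : E3) (w : ℤ → E3) (ϱ : ℝ) (U : Finset (Cell 2 × ℤ)) : Finset ((Cell 2 × ℤ) × (Cell 2 × ℤ)) :=
  (U ×ˢ U).filter fun e => e.1 ≠ e.2 ∧ ‖lsite a b w e.2.1 e.2.2 - lsite a b w e.1.1 e.1.2‖ ≤ ϱ

/-- Auxiliary step (`mem nearPairs`). [formal bookkeeping] -/
theorem mem_nearPairs {U : Finset (Cell 2 × ℤ)} {e : (Cell 2 × ℤ) × (Cell 2 × ℤ)} :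
    e ∈ nearPairs a b w ϱ U ↔ e.1 ∈ U ∧ e.2 ∈ U ∧ e.1 ≠ e.2 ∧ ‖lsite a b w e.2.1 e.2.2 - lsite a b w e.1.1 e.1.2‖ ≤ ϱ := by
  unfold nearPairs
  rw [Finset.mem_filter, Finset.mem_product, and_assoc]

/-- Auxiliary step (`swap mem nearPairs`). [formal bookkeeping] -/
theorem swap_mem_nearPairs {U : Finset (Cell 2 × ℤ)} {e : (Cell 2 × ℤ) × (Cell 2 × ℤ)} (he : e ∈ nearPairs a b w ϱ U) :
    e.swap ∈ nearPairs a b w ϱ U := by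
  rw [mem_nearPairs] at he ⊢
  obtain ⟨h1, h2, h3, h4⟩ := he
  refine ⟨h2, h1, h3.symm, ?_⟩
  rw [Prod.fst_swap, Prod.snd_swap, norm_sub_rev]
  exact h4

/-- the defect sum as a finite sum over any window containing the `ϱ`-near sites. [this file, g59] -/
theorem defectSum_eq_sum {U : Finset (Cell 2 × ℤ)} {X : Cell 2 × ℤ} (hU : ∀ Y, ‖lsite a b w Y.1 Y.2 - lsite a b w X.1 X.2‖ ≤ ϱ → Y ∈ U)
    (φ : Cell 2 → ℤ → E3) :
    defectSum ϱ a b w φ X = ∑ Y ∈ U, (if Y ≠ X ∧ ‖lsite a b w Y.1 Y.2 - lsite a b w X.1 X.2‖ ≤ ϱ then defectPair a b w φ X Y else 0) :=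
  tsum_ite_near_eq_sum hU _

/-- ★ **THE DEFECT PAIRING AS A PAIR SUM**: for a test field `ψ` vanishing off `P ⊆ U`, `U` containing the `ϱ`-near sites of `P`,
`Σ_P ⟪defectSum X, ψ X⟫ = Σ_{nearPairs U ϱ} ⟪G e.1 e.2, ψ e.1⟫`. [this file, g59] -/
theorem sum_inner_defectSum_eq {P U : Finset (Cell 2 × ℤ)} (hPU : P ⊆ U)
    (hU : ∀ X ∈ P, ∀ Y, ‖lsite a b w Y.1 Y.2 - lsite a b w X.1 X.2‖ ≤ ϱ → Y ∈ U) (φ : Cell 2 → ℤ → E3) {ψ : Cell 2 → ℤ → E3}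
    (hψ : ∀ X : Cell 2 × ℤ, X ∉ P → ψ X.1 X.2 = 0) :
    ∑ X ∈ P, ⟪defectSum ϱ a b w φ X, ψ X.1 X.2⟫_ℝ = ∑ e ∈ nearPairs a b w ϱ U, ⟪defectPair a b w φ e.1 e.2, ψ e.1.1 e.1.2⟫_ℝ := by
  have h1 : ∑ X ∈ P, ⟪defectSum ϱ a b w φ X, ψ X.1 X.2⟫_ℝ = ∑ X ∈ U, ⟪defectSum ϱ a b w φ X, ψ X.1 X.2⟫_ℝ := by
    refine Finset.sum_subset hPU fun X _ hXP => ?_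
    rw [hψ X hXP, inner_zero_right]
  rw [h1, nearPairs, Finset.sum_filter, Finset.sum_product]
  refine Finset.sum_congr rfl fun X _ => ?_
  dsimp only
  by_cases hXP : X ∈ P
  · rw [defectSum_eq_sum (hU X hXP), sum_inner]
    refine Finset.sum_congr rfl fun Y _ => ?_
    by_cases h : Y ≠ X ∧ ‖lsite a b w Y.1 Y.2 - lsite a b w X.1 X.2‖ ≤ ϱ
    · rw [if_pos h, if_pos ⟨fun e => h.1 e.symm, h.2⟩]
    · rw [if_neg h, inner_zero_left, if_neg fun h' => h ⟨fun e => h'.1 e.symm, h'.2⟩]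
  · rw [hψ X hXP, inner_zero_right]
    refine (Finset.sum_eq_zero fun Y _ => ?_).symm
    split_ifs
    · exact inner_zero_right _
    · rfl

/-- ★ **ANTISYMMETRISATION**: `Σ_{nearPairs} ⟪G e.1 e.2, ψ e.1⟫ = ½ Σ_{nearPairs} ⟪G e.1 e.2, ψ e.1 − ψ e.2⟫` (swap the pair; `G` is antisymmetric). [this file, g59] -/
theorem sum_nearPairs_antisymm (U : Finset (Cell 2 × ℤ)) (φ ψ : Cell 2 → ℤ → E3) :
    ∑ e ∈ nearPairs a b w ϱ U, ⟪defectPair a b w φ e.1 e.2, ψ e.1.1 e.1.2⟫_ℝ =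
      1 / 2 * ∑ e ∈ nearPairs a b w ϱ U, ⟪defectPair a b w φ e.1 e.2, ψ e.1.1 e.1.2 - ψ e.2.1 e.2.2⟫_ℝ := by
  have hswap : ∑ e ∈ nearPairs a b w ϱ U, ⟪defectPair a b w φ e.1 e.2, ψ e.1.1 e.1.2⟫_ℝ =
      ∑ e ∈ nearPairs a b w ϱ U, ⟪defectPair a b w φ e.2 e.1, ψ e.2.1 e.2.2⟫_ℝ := by
    refine Finset.sum_equiv (Equiv.prodComm _ _) (fun e => ?_) (fun e _ => ?_)
    · rw [Equiv.prodComm_apply]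
      exact ⟨fun h => swap_mem_nearPairs h, fun h => by simpa using swap_mem_nearPairs h⟩
    · rw [Equiv.prodComm_apply, Prod.fst_swap, Prod.snd_swap]
  have hneg : ∑ e ∈ nearPairs a b w ϱ U, ⟪defectPair a b w φ e.2 e.1, ψ e.2.1 e.2.2⟫_ℝ =
      -∑ e ∈ nearPairs a b w ϱ U, ⟪defectPair a b w φ e.1 e.2, ψ e.2.1 e.2.2⟫_ℝ := by
    rw [← Finset.sum_neg_distrib]
    refine Finset.sum_congr rfl fun e _ => ?_
    rw [defectPair_swap, inner_neg_left]
  have h3 : ∑ e ∈ nearPairs a b w ϱ U, ⟪defectPair a b w φ e.1 e.2, ψ e.1.1 e.1.2 - ψ e.2.1 e.2.2⟫_ℝ =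
      ∑ e ∈ nearPairs a b w ϱ U, ⟪defectPair a b w φ e.1 e.2, ψ e.1.1 e.1.2⟫_ℝ -
        ∑ e ∈ nearPairs a b w ϱ U, ⟪defectPair a b w φ e.1 e.2, ψ e.2.1 e.2.2⟫_ℝ := by
    rw [← Finset.sum_sub_distrib]
    exact Finset.sum_congr rfl fun e _ => inner_sub_right _ _ _
  rw [h3]
  linarith [hswap, hneg]

/-- ★ **THE DEFECT PAIRING BOUND**: `|Σ_P ⟪defectSum X, ψ X⟫| ≤ ½ Σ_{nearPairs U ϱ} ‖G e.1 e.2‖·‖ψ e.1 − ψ e.2‖`. [this file, g59] -/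
theorem abs_sum_inner_defectSum_le {P U : Finset (Cell 2 × ℤ)} (hPU : P ⊆ U)
    (hU : ∀ X ∈ P, ∀ Y, ‖lsite a b w Y.1 Y.2 - lsite a b w X.1 X.2‖ ≤ ϱ → Y ∈ U) (φ : Cell 2 → ℤ → E3) {ψ : Cell 2 → ℤ → E3}
    (hψ : ∀ X : Cell 2 × ℤ, X ∉ P → ψ X.1 X.2 = 0) :
    |∑ X ∈ P, ⟪defectSum ϱ a b w φ X, ψ X.1 X.2⟫_ℝ| ≤
      1 / 2 * ∑ e ∈ nearPairs a b w ϱ U, ‖defectPair a b w φ e.1 e.2‖ * ‖ψ e.1.1 e.1.2 - ψ e.2.1 e.2.2‖ := by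
  rw [sum_inner_defectSum_eq hPU hU φ hψ, sum_nearPairs_antisymm, abs_mul, abs_of_pos (by norm_num : (0 : ℝ) < 1 / 2)]
  refine mul_le_mul_of_nonneg_left ((Finset.abs_sum_le_sum_abs _ _).trans (Finset.sum_le_sum fun e _ => ?_)) (by norm_num)
  exact abs_real_inner_le_norm _ _

/-! ### XH.2  (I1) on near pairs and Cauchy–Schwarz -/

/-- ★ **(I1) + CAUCHY–SCHWARZ ON THE NEAR PAIRS**: with a Taylor constant `C_T` (`‖defectKernel z v‖ ≤ C_T‖v‖²` for `‖z‖ ≥ 27/32`, `‖v‖ ≤ 1/4` — Q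
`norm_defectKernel_le` under (I1)), the `27/32`-separation of the model set and the gradient bound `‖φ e.1 − φ e.2‖ ≤ δ⋆ ≤ 1/4` on near pairs,
`Σ ‖G‖·‖ψ e.1 − ψ e.2‖ ≤ C_T·δ⋆·√(Σ ‖φ e.1 − φ e.2‖²)·√(Σ ‖ψ e.1 − ψ e.2‖²)`. [this file, g59] -/
theorem sum_nearPairs_defect_le {CT δs : ℝ} (hCT0 : 0 ≤ CT)
    (hCT : ∀ z v : E3, 27 / 32 ≤ ‖z‖ → ‖v‖ ≤ 1 / 4 → ‖defectKernel z v‖ ≤ CT * ‖v‖ ^ 2)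
    (hsepH : IsSep (27 / 32) (Layered a b w)) (hc : 0 < c) (hcr : IsLayeredCrystal c a b w) (U : Finset (Cell 2 × ℤ))
    {φ : Cell 2 → ℤ → E3} (hδs0 : 0 ≤ δs) (hδs : δs ≤ 1 / 4)
    (hgrad : ∀ e ∈ nearPairs a b w ϱ U, ‖φ e.1.1 e.1.2 - φ e.2.1 e.2.2‖ ≤ δs) (ψ : Cell 2 → ℤ → E3) :
    ∑ e ∈ nearPairs a b w ϱ U, ‖defectPair a b w φ e.1 e.2‖ * ‖ψ e.1.1 e.1.2 - ψ e.2.1 e.2.2‖ ≤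
      CT * δs * (Real.sqrt (∑ e ∈ nearPairs a b w ϱ U, ‖φ e.1.1 e.1.2 - φ e.2.1 e.2.2‖ ^ 2) *
        Real.sqrt (∑ e ∈ nearPairs a b w ϱ U, ‖ψ e.1.1 e.1.2 - ψ e.2.1 e.2.2‖ ^ 2)) := by
  have hinj := injective_lsite_of_isLayeredCrystal hc hcr
  calc ∑ e ∈ nearPairs a b w ϱ U, ‖defectPair a b w φ e.1 e.2‖ * ‖ψ e.1.1 e.1.2 - ψ e.2.1 e.2.2‖
      ≤ ∑ e ∈ nearPairs a b w ϱ U, CT * δs * ‖φ e.1.1 e.1.2 - φ e.2.1 e.2.2‖ * ‖ψ e.1.1 e.1.2 - ψ e.2.1 e.2.2‖ := by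
        refine Finset.sum_le_sum fun e he => mul_le_mul_of_nonneg_right ?_ (norm_nonneg _)
        obtain ⟨-, -, hne, -⟩ := mem_nearPairs.1 he
        have hz : 27 / 32 ≤ ‖lsite a b w e.1.1 e.1.2 - lsite a b w e.2.1 e.2.2‖ := by
          rw [← dist_eq_norm]
          exact hsepH _ (lsite_mem_layered a b w e.1) _ (lsite_mem_layered a b w e.2) fun h => hne (hinj h)
        have hv := hgrad e he
        calc ‖defectPair a b w φ e.1 e.2‖ ≤ CT * ‖φ e.1.1 e.1.2 - φ e.2.1 e.2.2‖ ^ 2 := hCT _ _ hz (hv.trans hδs)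
          _ = CT * ‖φ e.1.1 e.1.2 - φ e.2.1 e.2.2‖ * ‖φ e.1.1 e.1.2 - φ e.2.1 e.2.2‖ := by ring
          _ ≤ CT * δs * ‖φ e.1.1 e.1.2 - φ e.2.1 e.2.2‖ := by
              rw [mul_assoc, mul_assoc]
              exact mul_le_mul_of_nonneg_left (mul_le_mul_of_nonneg_right hv (norm_nonneg _)) hCT0
    _ = CT * δs * ∑ e ∈ nearPairs a b w ϱ U, ‖φ e.1.1 e.1.2 - φ e.2.1 e.2.2‖ * ‖ψ e.1.1 e.1.2 - ψ e.2.1 e.2.2‖ := by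
        rw [Finset.mul_sum]
        exact Finset.sum_congr rfl fun e _ => by ring
    _ ≤ _ := mul_le_mul_of_nonneg_left (Real.sum_mul_le_sqrt_mul_sqrt _ _ _) (mul_nonneg hCT0 hδs0)

/-! ### XH.3  Near-pair sums are index energies -/

/-- ★ **NEAR-PAIR SUMS ARE INDEX ENERGIES**: in a `c`-co-Lipschitz crystal a `ϱ`-near pair has index distance `≤ ϱ/c`, so
`Σ_{nearPairs (idxBallF X₀ m) ϱ} ‖f e.1 − f e.2‖² ≤ dictA c ϱ · idxEnergy f (idxBall X₀ m)` (the re-indexing of XF.3: VA `dispSqOn`, VB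
`dispSqOn_le_of_idxNorm_le`). [this file, g59] -/
theorem sum_nearPairs_sq_le (hc : 0 < c) (hcr : IsLayeredCrystal c a b w) (X₀ : Cell 2 × ℤ) (m ϱ : ℝ) (f : Cell 2 → ℤ → E3) :
    ∑ e ∈ nearPairs a b w ϱ (idxBallF X₀ m), ‖f e.1.1 e.1.2 - f e.2.1 e.2.2‖ ^ 2 ≤ dictA c ϱ * idxEnergy f (idxBall X₀ m) := by
  set R₀ : ℕ := ⌈ϱ / (2 * c)⌉₊ with hR₀
  set B : Finset (Cell 2 × ℤ) := idxBallF X₀ m with hB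
  set T : (Cell 2 × ℤ) × (Cell 2 × ℤ) → (Cell 2 × ℤ) × (Cell 2 × ℤ) := fun e => (e.2 - e.1, e.1) with hT
  have hTinj : InjOn T ↑(nearPairs a b w ϱ B) := by
    intro x _ y _ h
    have h2 : x.1 = y.1 := congrArg Prod.snd h
    have h1 : x.2 - x.1 = y.2 - y.1 := congrArg Prod.fst h
    have h3 : x.2 = y.2 := by
      rw [h2] at h1
      exact sub_left_injective h1
    exact Prod.ext h2 h3
  have hϱc : ϱ / c ≤ 2 * (R₀ : ℝ) := by
    have e : ϱ / c = 2 * (ϱ / (2 * c)) := by field_simp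
    rw [e]
    exact mul_le_mul_of_nonneg_left (Nat.le_ceil _) (by norm_num)
  have hnorm : ∀ e ∈ nearPairs a b w ϱ B, idxNorm (e.2 - e.1) ≤ 2 * R₀ := by
    intro e he
    obtain ⟨-, -, -, hd⟩ := mem_nearPairs.1 he
    have h1 : (idxNorm (e.2 - e.1) : ℝ) ≤ dist e.1 e.2 := idxNorm_le_dist _ _
    have h2 : dist e.1 e.2 ≤ ϱ / c := by
      rw [le_div_iff₀ hc, dist_comm, mul_comm]
      exact (hcr e.2 e.1).trans hd
    have h3 : (idxNorm (e.2 - e.1) : ℝ) ≤ ((2 * R₀ : ℕ) : ℝ) := by push_cast; linarith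
    exact_mod_cast h3
  calc ∑ e ∈ nearPairs a b w ϱ B, ‖f e.1.1 e.1.2 - f e.2.1 e.2.2‖ ^ 2
      = ∑ e ∈ nearPairs a b w ϱ B, dispSqFam f (T e).1 (T e).2 := by
        refine Finset.sum_congr rfl fun e _ => ?_
        simp only [hT, dispSqFam, add_sub_cancel, norm_sub_rev]
    _ = ∑ y ∈ (nearPairs a b w ϱ B).image T, dispSqFam f y.1 y.2 := by rw [Finset.sum_image hTinj]
    _ = ∑ y ∈ (nearPairs a b w ϱ B).image T, (if y.2 + y.1 ∈ B then dispSqFam f y.1 y.2 else 0) := by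
        refine Finset.sum_congr rfl fun y hy => ?_
        obtain ⟨e, he, rfl⟩ := Finset.mem_image.1 hy
        obtain ⟨-, he2, -⟩ := mem_nearPairs.1 he
        have hm : (T e).2 + (T e).1 ∈ B := by
          simp only [hT, add_sub_cancel]
          exact he2
        rw [if_pos hm]
    _ ≤ ∑ y ∈ idxBox (2 * R₀) ×ˢ B, (if y.2 + y.1 ∈ B then dispSqFam f y.1 y.2 else 0) := by
        refine Finset.sum_le_sum_of_subset_of_nonneg (fun y hy => ?_) fun y _ _ => by
          split_ifs
          · exact dispSqFam_nonneg _ _ _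
          · exact le_rfl
        obtain ⟨e, he, rfl⟩ := Finset.mem_image.1 hy
        obtain ⟨he1, -, -⟩ := mem_nearPairs.1 he
        exact Finset.mem_product.2 ⟨mem_idxBox (hnorm e he), he1⟩
    _ = ∑ u ∈ idxBox (2 * R₀), dispSqOn B f u := by rw [Finset.sum_product]; rfl
    _ ≤ ∑ u ∈ idxBox (2 * R₀), 36 * (R₀ : ℝ) ^ 2 * idxEnergy f (idxBall X₀ m) :=
        Finset.sum_le_sum fun u hu => dispSqOn_le_of_idxNorm_le X₀ m f (idxNorm_le_of_mem_idxBox hu)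
    _ = dictA c ϱ * idxEnergy f (idxBall X₀ m) := by
        rw [Finset.sum_const, card_idxBox, nsmul_eq_mul, dictA]
        push_cast
        ring

end Defect

/-! ### XH.4  Vanishing test fields: (HC)'s energy set -/

/-- the unit neighbourhood of an index set — the energy set of (HC) `HarmonicComparisonZ`. [this file, g59] -/
def nbhd1 (P : Set (Cell 2 × ℤ)) : Set (Cell 2 × ℤ) := {X | ∃ Y ∈ P, dist X Y ≤ 1}

/-- Auxiliary step (`subset nbhd1`). [formal bookkeeping] -/
theorem subset_nbhd1 (P : Set (Cell 2 × ℤ)) : P ⊆ nbhd1 P := fun X hX => ⟨X, hX, by rw [dist_self]; exact zero_le_one⟩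

/-- ★ a test field vanishing off `P` has the same index energy on every `B ⊇ nbhd1 P` as on `nbhd1 P`. [this file, g59] -/
theorem idxEnergy_eq_nbhd1_of_vanish {P B : Set (Cell 2 × ℤ)} {ψ : Cell 2 → ℤ → E3} (hψ : ∀ X : Cell 2 × ℤ, X ∉ P → ψ X.1 X.2 = 0)
    (hB : nbhd1 P ⊆ B) : idxEnergy ψ B = idxEnergy ψ (nbhd1 P) := by
  unfold idxEnergy
  refine finsum_mem_inter_support_eq _ _ _ (Set.ext fun x => ⟨fun hx => ⟨?_, hx.2⟩, fun hx => ⟨⟨hB hx.1.1, hB hx.1.2.1, hx.1.2.2⟩, hx.2⟩⟩)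
  obtain ⟨⟨-, -, hd⟩, hne⟩ := hx
  rw [mem_support] at hne
  by_cases h1 : x.1 ∈ P
  · exact ⟨subset_nbhd1 P h1, ⟨x.1, h1, by rw [dist_comm]; exact hd⟩, hd⟩
  · by_cases h2 : x.2 ∈ P
    · exact ⟨⟨x.2, h2, hd⟩, subset_nbhd1 P h2, hd⟩
    · exact absurd (by rw [hψ _ h1, hψ _ h2, sub_zero, norm_zero, zero_pow two_ne_zero]) hne

/-- index energies are monotone in the (finite) index set. [formal bookkeeping] -/
theorem idxEnergy_mono_set {A B : Set (Cell 2 × ℤ)} (hAB : A ⊆ B) (hBf : B.Finite) (ψ : Cell 2 → ℤ → E3) : idxEnergy ψ A ≤ idxEnergy ψ B := by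
  unfold idxEnergy
  have hfin : {x : (Cell 2 × ℤ) × (Cell 2 × ℤ) | x.1 ∈ B ∧ x.2 ∈ B ∧ dist x.1 x.2 ≤ 1}.Finite :=
    (hBf.prod hBf).subset fun x hx => mk_mem_prod hx.1 hx.2.1
  have hsub : {x : (Cell 2 × ℤ) × (Cell 2 × ℤ) | x.1 ∈ A ∧ x.2 ∈ A ∧ dist x.1 x.2 ≤ 1} ⊆
      {x : (Cell 2 × ℤ) × (Cell 2 × ℤ) | x.1 ∈ B ∧ x.2 ∈ B ∧ dist x.1 x.2 ≤ 1} := fun x hx => ⟨hAB hx.1, hAB hx.2.1, hx.2.2⟩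
  rw [finsum_mem_eq_finite_toFinset_sum _ (hfin.subset hsub), finsum_mem_eq_finite_toFinset_sum _ hfin]
  exact Finset.sum_le_sum_of_subset_of_nonneg (fun x hx => by rw [Finite.mem_toFinset] at hx ⊢; exact hsub hx) fun _ _ _ => sq_nonneg _

/-! ### XH.5  The lifted test field -/

section Lift

variable {S : Set E3} {Ψ : E3 → E3} {a b : E3} {w : ℤ → E3} {c : ℝ}

/-- the LIFT of an index test field to `S`: `liftField S Ψ a b w ψ = 1_S · (ψ ∘ idxOf ∘ Ψ)`. [this file, g59] -/
def liftField (S : Set E3) (Ψ : E3 → E3) (a b : E3) (w : ℤ → E3) (ψ : Cell 2 → ℤ → E3) : E3 → E3 :=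
  S.indicator fun y => ψ (idxOf a b w (Ψ y)).1 (idxOf a b w (Ψ y)).2

/-- Auxiliary step (`liftField of mem`). [formal bookkeeping] -/
theorem liftField_of_mem (ψ : Cell 2 → ℤ → E3) {y : E3} (hy : y ∈ S) :
    liftField S Ψ a b w ψ y = ψ (idxOf a b w (Ψ y)).1 (idxOf a b w (Ψ y)).2 :=
  indicator_of_mem hy _

/-- Auxiliary step (`liftField of not mem`). [formal bookkeeping] -/
theorem liftField_of_not_mem (ψ : Cell 2 → ℤ → E3) {y : E3} (hy : y ∉ S) : liftField S Ψ a b w ψ y = 0 :=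
  indicator_of_notMem hy _

/-- Auxiliary step (`idxOf apply atomOf`). [formal bookkeeping] -/
theorem idxOf_apply_atomOf (hbij : BijOn Ψ S (Layered a b w)) (hc : 0 < c) (hcr : IsLayeredCrystal c a b w) (X : Cell 2 × ℤ) :
    idxOf a b w (Ψ (atomOf S Ψ a b w X)) = X := by
  rw [apply_atomOf hbij, idxOf_lsite hc hcr]

/-- Auxiliary step (`liftField atomOf`). [formal bookkeeping] -/
theorem liftField_atomOf (hbij : BijOn Ψ S (Layered a b w)) (hc : 0 < c) (hcr : IsLayeredCrystal c a b w) (ψ : Cell 2 → ℤ → E3)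
    (X : Cell 2 × ℤ) : liftField S Ψ a b w ψ (atomOf S Ψ a b w X) = ψ X.1 X.2 := by
  rw [liftField_of_mem ψ (atomOf_mem hbij X), idxOf_apply_atomOf hbij hc hcr]

/-- ★ the lift of a field vanishing off `P` vanishes off `S ∩ ball x t` as soon as the atoms of `P` lie in `ball x t` — the support hypothesis of (I4ˢ). [this file, g59] -/
theorem liftField_eq_zero (hbij : BijOn Ψ S (Layered a b w)) {P : Set (Cell 2 × ℤ)} {ψ : Cell 2 → ℤ → E3}
    (hψ : ∀ X : Cell 2 × ℤ, X ∉ P → ψ X.1 X.2 = 0) {x : E3} {t : ℝ} (hPt : ∀ X ∈ P, atomOf S Ψ a b w X ∈ ball x t) {y : E3}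
    (hy : y ∉ S ∩ ball x t) : liftField S Ψ a b w ψ y = 0 := by
  by_cases hyS : y ∈ S
  · rw [liftField_of_mem ψ hyS]
    refine hψ _ fun hIP => hy ⟨hyS, ?_⟩
    have h := hPt _ hIP
    rwa [atomOf_idxOf_apply hbij hyS] at h
  · exact liftField_of_not_mem ψ hyS

/-- ★ **THE LIFTED PAIRING IS THE INDEX PAIRING**: `Σᶠ_{y ∈ S ∩ ball x t} ⟪F y, liftField ψ y⟫ = Σ_{X ∈ P} ⟪F (atomOf X), ψ X⟫` for `ψ = 0` off `P` with atoms in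
`ball x t` (injectivity of the atom map). [this file, g59] -/
theorem finsum_inner_liftField_eq (hbij : BijOn Ψ S (Layered a b w)) (hc : 0 < c) (hcr : IsLayeredCrystal c a b w) {P : Finset (Cell 2 × ℤ)}
    {ψ : Cell 2 → ℤ → E3} (hψ : ∀ X : Cell 2 × ℤ, X ∉ P → ψ X.1 X.2 = 0) {x : E3} {t : ℝ}
    (hPt : ∀ X ∈ P, atomOf S Ψ a b w X ∈ ball x t) (F : E3 → E3) :
    ∑ᶠ y ∈ S ∩ ball x t, ⟪F y, liftField S Ψ a b w ψ y⟫_ℝ = ∑ X ∈ P, ⟪F (atomOf S Ψ a b w X), ψ X.1 X.2⟫_ℝ := by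
  have h1 : ∑ᶠ y ∈ S ∩ ball x t, ⟪F y, liftField S Ψ a b w ψ y⟫_ℝ = ∑ᶠ y ∈ atomOf S Ψ a b w '' ↑P, ⟪F y, liftField S Ψ a b w ψ y⟫_ℝ := by
    refine finsum_mem_inter_support_eq _ _ _ (Set.ext fun y => ⟨fun hy => ⟨?_, hy.2⟩, fun hy => ⟨?_, hy.2⟩⟩)
    · obtain ⟨⟨hyS, -⟩, hne⟩ := hy
      rw [mem_support] at hne
      have hIP : idxOf a b w (Ψ y) ∈ P := by
        by_contra hIP
        apply hne
        rw [liftField_of_mem ψ hyS, hψ _ hIP, inner_zero_right]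
      exact ⟨_, hIP, atomOf_idxOf_apply hbij hyS⟩
    · obtain ⟨⟨X, hXP, rfl⟩, -⟩ := hy
      exact ⟨atomOf_mem hbij X, hPt X hXP⟩
  rw [h1, finsum_mem_image (atomOf_injective hbij hc hcr).injOn, finsum_mem_coe_finset]
  exact Finset.sum_congr rfl fun X _ => by rw [liftField_atomOf hbij hc hcr]

/-- ★ **THE LIFT'S BOND ENERGY IS AN INDEX ENERGY** (XF.3): `bondEnergy Q (liftField ψ) ≤ dictA c D · idxEnergy ψ (idxBall X₀ m)` for `Q ⊆ S` finite whose index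
sites lie in `idxBall X₀ m`, `Ψ` `4 ↦ D` tear-free. [this file, g59] -/
theorem bondEnergy_liftField_le (hbij : BijOn Ψ S (Layered a b w)) (hc : 0 < c) (hcr : IsLayeredCrystal c a b w) {D : ℝ}
    (h4D : ∀ x ∈ S, ∀ p ∈ S, dist p x ≤ 4 → dist (Ψ p) (Ψ x) ≤ D) {Q : Set E3} (hQS : Q ⊆ S) (hQ : Q.Finite) {X₀ : Cell 2 × ℤ} {m : ℝ}
    (hQB : ∀ p ∈ Q, idxOf a b w (Ψ p) ∈ idxBall X₀ m) (ψ : Cell 2 → ℤ → E3) :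
    bondEnergy Q (liftField S Ψ a b w ψ) ≤ dictA c D * idxEnergy ψ (idxBall X₀ m) :=
  bondEnergy_comp_idxOf_le hbij hc hcr h4D hQS hQ hQB ψ fun _ hp => liftField_of_mem ψ (hQS hp)

end Lift

end Summit.AtomisticToContinuum.Crystallization.Theorems.ChartedZeroExcessLayeredLatticeLiouville

end
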